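import Mathlib.Order.Filter.Ultrafilter.Basic
import Mathlib.Analysis.Normed.Group.Continuity
import Mathlib.Analysis.SpecificLimits.Normed
import Mathlib.Analysis.SpecificLimits.Basic
import Mathlib.Data.Fin.Tuple.Basic
import HarnessLib

/-!
# An invariant mean on `ℤ^d` by iterated Banach limits (gauge-boot, L1/L4 supplement)

HONEST FRAMING (cell `pub-gaugeboot`, page 1 of every file): the venture produces certified bounds
on lattice expectations at stated coupling, gauge group, dimension and torus size; NOT a mass gap,
NOT a continuum limit, NOT a string tension; NOT Yang–Mills-summit-bearing (barriers
`FixedCouplingUltralocality`, `PerturbativeInvisibility`). Pure analysis; it certifies no number.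

## Content

The translation group `ℤ^d` of the infinite lattice is amenable: there is a linear functional on
the bounded functions `ℤ^d → ℝ` which is positive, normalised and invariant under every
translation. This file gives the classical explicit one by ITERATED BANACH LIMITS,
`zdMean 0 g = g ()` and `zdMean (d + 1) g = LIM_n zdMean d (g (n, ·))`, with `LIM` a Banach limit
taken in the first coordinate over `n ≥ 0` — shift invariance makes the half-line enough for
invariance under the whole group.

* `cLim a` — the Banach limit used: Cesàro means along the free ultrafilter `hyperfilter ℕ`
  (the construction of `Literature/Analysis/FunctionSpaces/BanachLimit.lean`, Conway §III.7 Thm 7.1,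
  reproduced here in the minimal form needed because that module is not in the build closure this
  file can import; TODO: import it instead once it is built): `abs_cLim_le`, `cLim_add`,
  `cLim_smul`, `cLim_const`, `cLim_le_of_le`, `le_cLim_of_le`, `cLim_shift_add`;
* `zdMean d g`; `abs_zdMean_le` (norm `≤ 1`), `zdMean_add`, `zdMean_smul`, `zdMean_neg`,
  `zdMean_sub`, `zdMean_const`, `zdMean_le_of_le`, `le_zdMean_of_le`, `zdMean_nonneg` (every
  statement about a non-constant `g` carries the boundedness hypothesis `∀ x, |g x| ≤ M`);
* `cLim_intShift` — the Banach limit of the restriction to `ℕ` of a bounded two-sided sequence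
  is invariant under all INTEGER shifts;
* ★ `zdMean_shift` / `zdMean_shift'` — TRANSLATION INVARIANCE `zdMean d (g (· + a)) = zdMean d g`
  for every `a ∈ ℤ^d`.

This is the Reynolds operator of the (infinite, abelian) translation group used by
`BootstrapTranslationAveraging.lean` to average bootstrap functionals on `ℤ^d`.

References: S. Banach, Théorie des opérations linéaires (1932) Ch. II §3; M. M. Day, Illinois J.
Math. 1 (1957) 509 (amenable semigroups; abelian groups are amenable); J. B. Conway, A Course in
Functional Analysis, §III.7. Folklore.
-/

noncomputable section

open Filter Topology Finset

namespace Summit.QuantumFields.GaugeBoot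

/-! ## A Banach limit: Cesàro means along a free ultrafilter -/

namespace CesaroLimit

/-- The Cesàro mean `(a 0 + ⋯ + a n) / (n + 1)`. [folklore] -/
def cesaroAvg (a : ℕ → ℝ) (n : ℕ) : ℝ := (∑ j ∈ range (n + 1), a j) / (n + 1)

/-- Cesàro means are additive. -/
theorem cesaroAvg_add (a b : ℕ → ℝ) (n : ℕ) : cesaroAvg (a + b) n = cesaroAvg a n + cesaroAvg b n := by
  simp [cesaroAvg, sum_add_distrib, add_div]

/-- Cesàro means are homogeneous. -/
theorem cesaroAvg_smul (t : ℝ) (a : ℕ → ℝ) (n : ℕ) : cesaroAvg (t • a) n = t * cesaroAvg a n := by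
  simp [cesaroAvg, ← mul_sum, mul_div_assoc]

/-- Cesàro means of a constant. -/
theorem cesaroAvg_const (c : ℝ) (n : ℕ) : cesaroAvg (fun _ => c) n = c := by
  simp only [cesaroAvg, sum_const, card_range, nsmul_eq_mul]
  have : (n : ℝ) + 1 ≠ 0 := by positivity
  field_simp
  push_cast
  ring

/-- Cesàro means of a sequence with terms `≤ t` are `≤ t`. -/
theorem cesaroAvg_le_of_le {a : ℕ → ℝ} {t : ℝ} (h : ∀ n, a n ≤ t) (n : ℕ) : cesaroAvg a n ≤ t := by
  unfold cesaroAvg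
  rw [div_le_iff₀ (by positivity)]
  calc ∑ j ∈ range (n + 1), a j ≤ ∑ _j ∈ range (n + 1), t := sum_le_sum fun j _ => h j
    _ = t * (n + 1) := by simp [mul_comm]

/-- Cesàro means of a sequence with terms `≥ t` are `≥ t`. -/
theorem le_cesaroAvg_of_le {a : ℕ → ℝ} {t : ℝ} (h : ∀ n, t ≤ a n) (n : ℕ) : t ≤ cesaroAvg a n := by
  unfold cesaroAvg
  rw [le_div_iff₀ (by positivity)]
  calc t * (n + 1) = ∑ _j ∈ range (n + 1), t := by simp [mul_comm]
    _ ≤ ∑ j ∈ range (n + 1), a j := sum_le_sum fun j _ => h j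

/-- `|cesaroAvg a n| ≤ M` if `|a n| ≤ M` for all `n`. -/
theorem abs_cesaroAvg_le {a : ℕ → ℝ} {M : ℝ} (hM : ∀ n, |a n| ≤ M) (n : ℕ) : |cesaroAvg a n| ≤ M :=
  abs_le.mpr ⟨by simpa using le_cesaroAvg_of_le (fun n => (abs_le.mp (hM n)).1) n,
    cesaroAvg_le_of_le (fun n => (abs_le.mp (hM n)).2) n⟩

/-- The Cesàro means of the shifted sequence differ from those of the sequence by
`(a (n+1) - a 0) / (n+1)`. -/
theorem cesaroAvg_shift_sub (a : ℕ → ℝ) (n : ℕ) :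
    cesaroAvg (fun k => a (k + 1)) n - cesaroAvg a n = (a (n + 1) - a 0) / (n + 1) := by
  unfold cesaroAvg
  rw [← sub_div]
  congr 1
  have h := sum_range_succ' a (n + 1)
  rw [sum_range_succ] at h
  linarith

/-- For a bounded sequence this difference tends to `0`. -/
theorem tendsto_cesaroAvg_shift_sub {a : ℕ → ℝ} {M : ℝ} (hM : ∀ n, |a n| ≤ M) :
    Tendsto (fun n => cesaroAvg (fun k => a (k + 1)) n - cesaroAvg a n) atTop (𝓝 0) := by
  simp_rw [cesaroAvg_shift_sub]
  have hM0 : 0 ≤ M := (abs_nonneg _).trans (hM 0)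
  have h2 : Tendsto (fun n : ℕ => 2 * M * (1 / ((n : ℝ) + 1))) atTop (𝓝 0) := by
    simpa using tendsto_one_div_add_atTop_nhds_zero_nat.const_mul (2 * M)
  refine squeeze_zero_norm (fun n => ?_) h2
  rw [Real.norm_eq_abs, abs_div, abs_of_pos (by positivity : (0 : ℝ) < n + 1), div_eq_mul_one_div]
  gcongr
  calc |a (n + 1) - a 0| ≤ |a (n + 1)| + |a 0| := abs_sub _ _
    _ ≤ M + M := add_le_add (hM _) (hM _)
    _ = 2 * M := by ring

/-- The hyperfilter refines `atTop` on `ℕ`. -/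
private theorem hyperfilter_le_atTop : (↑(hyperfilter ℕ) : Filter ℕ) ≤ atTop :=
  hyperfilter_le_cofinite.trans_eq Nat.cofinite_eq_atTop

/-- A bounded real sequence converges along the hyperfilter. -/
private theorem exists_tendsto_hyperfilter {u : ℕ → ℝ} {M : ℝ} (hM : ∀ n, |u n| ≤ M) :
    ∃ l : ℝ, Tendsto u (↑(hyperfilter ℕ) : Filter ℕ) (𝓝 l) := by
  have hmem : Set.Icc (-M) M ∈ Ultrafilter.map u (hyperfilter ℕ) :=
    Ultrafilter.mem_map.2 (univ_mem' fun n => Set.mem_preimage.2 (Set.mem_Icc.2 (abs_le.1 (hM n))))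
  obtain ⟨l, -, hl⟩ := isCompact_Icc.ultrafilter_le_nhds' _ hmem
  refine ⟨l, ?_⟩
  rw [Ultrafilter.coe_map] at hl
  exact hl

/-- **The Banach limit used in this file**: the limit of the Cesàro means along `hyperfilter ℕ`
(an arbitrary value for unbounded sequences). [folklore] -/
def cLim (a : ℕ → ℝ) : ℝ := limUnder (↑(hyperfilter ℕ) : Filter ℕ) (cesaroAvg a)

/-- For a bounded sequence the Cesàro means converge to `cLim a` along the hyperfilter. -/
theorem tendsto_cLim {a : ℕ → ℝ} {M : ℝ} (hM : ∀ n, |a n| ≤ M) :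
    Tendsto (cesaroAvg a) (↑(hyperfilter ℕ) : Filter ℕ) (𝓝 (cLim a)) :=
  tendsto_nhds_limUnder (exists_tendsto_hyperfilter (abs_cesaroAvg_le hM))

/-- Additivity on bounded sequences. -/
theorem cLim_add {a b : ℕ → ℝ} {Ma Mb : ℝ} (ha : ∀ n, |a n| ≤ Ma) (hb : ∀ n, |b n| ≤ Mb) :
    cLim (a + b) = cLim a + cLim b := by
  have hab : ∀ n, |(a + b) n| ≤ Ma + Mb := fun n => (abs_add_le _ _).trans (add_le_add (ha n) (hb n))
  refine tendsto_nhds_unique (tendsto_cLim hab) ?_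
  exact ((tendsto_cLim ha).add (tendsto_cLim hb)).congr fun n => (cesaroAvg_add a b n).symm

/-- Homogeneity on bounded sequences. -/
theorem cLim_smul {a : ℕ → ℝ} {M : ℝ} (ha : ∀ n, |a n| ≤ M) (t : ℝ) :
    cLim (t • a) = t * cLim a := by
  have hta : ∀ n, |(t • a) n| ≤ |t| * M := fun n => by
    rw [Pi.smul_apply, smul_eq_mul, abs_mul]; exact mul_le_mul_of_nonneg_left (ha n) (abs_nonneg t)
  refine tendsto_nhds_unique (tendsto_cLim hta) ?_
  exact ((tendsto_cLim ha).const_mul t).congr fun n => (cesaroAvg_smul t a n).symm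

/-- Normalisation. -/
theorem cLim_const (c : ℝ) : cLim (fun _ => c) = c := by
  have hc : ∀ n : ℕ, |(fun _ : ℕ => c) n| ≤ |c| := fun _ => le_rfl
  refine tendsto_nhds_unique (tendsto_cLim hc) ?_
  exact tendsto_const_nhds.congr fun n => (cesaroAvg_const c n).symm

/-- Upper bound by a uniform bound of the terms. -/
theorem cLim_le_of_le {a : ℕ → ℝ} {M t : ℝ} (ha : ∀ n, |a n| ≤ M) (h : ∀ n, a n ≤ t) : cLim a ≤ t :=
  le_of_tendsto' (tendsto_cLim ha) fun n => cesaroAvg_le_of_le h n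

/-- Lower bound by a uniform bound of the terms. -/
theorem le_cLim_of_le {a : ℕ → ℝ} {M t : ℝ} (ha : ∀ n, |a n| ≤ M) (h : ∀ n, t ≤ a n) : t ≤ cLim a :=
  ge_of_tendsto' (tendsto_cLim ha) fun n => le_cesaroAvg_of_le h n

/-- Norm at most one. -/
theorem abs_cLim_le {a : ℕ → ℝ} {M : ℝ} (ha : ∀ n, |a n| ≤ M) : |cLim a| ≤ M :=
  abs_le.mpr ⟨le_cLim_of_le ha fun n => (abs_le.mp (ha n)).1, cLim_le_of_le ha fun n => (abs_le.mp (ha n)).2⟩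

/-- **Shift invariance.** [folklore] -/
theorem cLim_shift {a : ℕ → ℝ} {M : ℝ} (ha : ∀ n, |a n| ≤ M) : cLim (fun n => a (n + 1)) = cLim a := by
  have ha' : ∀ n, |a (n + 1)| ≤ M := fun n => ha (n + 1)
  refine tendsto_nhds_unique (tendsto_cLim ha') ?_
  have h0 : Tendsto (fun n => cesaroAvg (fun k => a (k + 1)) n - cesaroAvg a n)
      (↑(hyperfilter ℕ) : Filter ℕ) (𝓝 0) :=
    (tendsto_cesaroAvg_shift_sub ha).mono_left hyperfilter_le_atTop
  have h := h0.add (tendsto_cLim ha)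
  simp only [zero_add, sub_add_cancel] at h
  exact h

/-- Invariance under the `N`-fold shift. -/
theorem cLim_shift_add {a : ℕ → ℝ} {M : ℝ} (ha : ∀ n, |a n| ≤ M) (N : ℕ) :
    cLim (fun n => a (n + N)) = cLim a := by
  induction N with
  | zero => rfl
  | succ N ih =>
    have haN : ∀ n, |a (n + N)| ≤ M := fun n => ha (n + N)
    have h := cLim_shift haN
    simp only [add_assoc, add_comm 1 N] at h
    rw [← ih, ← h]

end CesaroLimit

open CesaroLimit


/-- **An invariant mean on `ℤ^d`** (on bounded functions `(Fin d → ℤ) → ℝ`; an arbitrary value on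
unbounded ones): iterated Banach limits, the first coordinate outermost. [folklore] -/
def zdMean : (d : ℕ) → ((Fin d → ℤ) → ℝ) → ℝ
  | 0, g => g fun i => i.elim0
  | d + 1, g => cLim fun n : ℕ => zdMean d fun c => g (Fin.cons (n : ℤ) c)

/-- `zdMean` in dimension `0` is evaluation at the point. -/
theorem zdMean_zero (g : (Fin 0 → ℤ) → ℝ) : zdMean 0 g = g fun i => i.elim0 := rfl

/-- `zdMean` in dimension `d + 1`: the Banach limit in the first coordinate of the
`d`-dimensional means of the slices. -/
theorem zdMean_succ {d : ℕ} (g : (Fin (d + 1) → ℤ) → ℝ) :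
    zdMean (d + 1) g = cLim fun n : ℕ => zdMean d fun c => g (Fin.cons (n : ℤ) c) := rfl

/-! ## Boundedness, linearity, positivity, normalisation -/

/-- **Norm at most one**: `|zdMean d g| ≤ M` whenever `|g| ≤ M`. [folklore] -/
theorem abs_zdMean_le : ∀ {d : ℕ} {g : (Fin d → ℤ) → ℝ} {M : ℝ}, (∀ x, |g x| ≤ M) → |zdMean d g| ≤ M
  | 0, _, _, hg => hg _
  | _ + 1, _, _, hg => abs_cLim_le fun _ => abs_zdMean_le fun _ => hg _

/-- **Additivity** on bounded functions. [folklore] -/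
theorem zdMean_add : ∀ {d : ℕ} {g h : (Fin d → ℤ) → ℝ} {Mg Mh : ℝ}, (∀ x, |g x| ≤ Mg) →
    (∀ x, |h x| ≤ Mh) → zdMean d (g + h) = zdMean d g + zdMean d h
  | 0, _, _, _, _, _, _ => rfl
  | d + 1, g, h, Mg, Mh, hg, hh => by
    have hG : ∀ n : ℕ, |zdMean d (fun c => g (Fin.cons (n : ℤ) c))| ≤ Mg :=
      fun n => abs_zdMean_le fun c => hg _
    have hH : ∀ n : ℕ, |zdMean d (fun c => h (Fin.cons (n : ℤ) c))| ≤ Mh :=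
      fun n => abs_zdMean_le fun c => hh _
    have heq : (fun n : ℕ => zdMean d (fun c => (g + h) (Fin.cons (n : ℤ) c))) =
        (fun n : ℕ => zdMean d (fun c => g (Fin.cons (n : ℤ) c))) +
          fun n : ℕ => zdMean d (fun c => h (Fin.cons (n : ℤ) c)) := by
      funext n
      have hs : (fun c => (g + h) (Fin.cons (n : ℤ) c)) =
          (fun c => g (Fin.cons (n : ℤ) c)) + fun c => h (Fin.cons (n : ℤ) c) := rfl
      rw [Pi.add_apply, hs]
      exact zdMean_add (fun c => hg _) (fun c => hh _)
    rw [zdMean_succ, heq, cLim_add hG hH, ← zdMean_succ, ← zdMean_succ]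

/-- **Homogeneity** on bounded functions. [folklore] -/
theorem zdMean_smul : ∀ {d : ℕ} {g : (Fin d → ℤ) → ℝ} {M : ℝ}, (∀ x, |g x| ≤ M) → ∀ t : ℝ,
    zdMean d (t • g) = t * zdMean d g
  | 0, _, _, _, _ => rfl
  | d + 1, g, M, hg, t => by
    have hG : ∀ n : ℕ, |zdMean d (fun c => g (Fin.cons (n : ℤ) c))| ≤ M :=
      fun n => abs_zdMean_le fun c => hg _
    have heq : (fun n : ℕ => zdMean d (fun c => (t • g) (Fin.cons (n : ℤ) c))) =
        t • fun n : ℕ => zdMean d (fun c => g (Fin.cons (n : ℤ) c)) := by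
      funext n
      have hs : (fun c => (t • g) (Fin.cons (n : ℤ) c)) = t • fun c => g (Fin.cons (n : ℤ) c) := rfl
      rw [Pi.smul_apply, smul_eq_mul, hs]
      exact zdMean_smul (fun c => hg _) t
    rw [zdMean_succ, heq, cLim_smul hG t, ← zdMean_succ]

/-- Negation. -/
theorem zdMean_neg {d : ℕ} {g : (Fin d → ℤ) → ℝ} {M : ℝ} (hg : ∀ x, |g x| ≤ M) :
    zdMean d (-g) = -zdMean d g := by
  have h := zdMean_smul hg (-1)
  rwa [neg_one_smul, neg_one_mul] at h

/-- Subtraction. -/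
theorem zdMean_sub {d : ℕ} {g h : (Fin d → ℤ) → ℝ} {Mg Mh : ℝ} (hg : ∀ x, |g x| ≤ Mg)
    (hh : ∀ x, |h x| ≤ Mh) : zdMean d (g - h) = zdMean d g - zdMean d h := by
  have hh' : ∀ x, |(-h) x| ≤ Mh := fun x => by rw [Pi.neg_apply, abs_neg]; exact hh x
  rw [sub_eq_add_neg, zdMean_add hg hh', zdMean_neg hh, ← sub_eq_add_neg]

/-- **Normalisation**: the mean of a constant is the constant. [folklore] -/
theorem zdMean_const : ∀ (d : ℕ) (c : ℝ), zdMean d (fun _ => c) = c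
  | 0, _ => rfl
  | d + 1, c => by
    rw [zdMean_succ]
    simp only [zdMean_const d c]
    exact cLim_const c

/-- A function constantly equal to `c` has mean `c`. -/
theorem zdMean_eq_of_forall_eq {d : ℕ} {g : (Fin d → ℤ) → ℝ} {c : ℝ} (h : ∀ x, g x = c) :
    zdMean d g = c := by
  rw [show g = fun _ => c from funext h]
  exact zdMean_const d c

/-- **Monotone bound above**: `g ≤ t` pointwise gives `zdMean d g ≤ t`. [folklore] -/
theorem zdMean_le_of_le : ∀ {d : ℕ} {g : (Fin d → ℤ) → ℝ} {M t : ℝ}, (∀ x, |g x| ≤ M) →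
    (∀ x, g x ≤ t) → zdMean d g ≤ t
  | 0, _, _, _, _, h => h _
  | _ + 1, _, _, _, hg, h =>
    cLim_le_of_le (fun _ => abs_zdMean_le fun _ => hg _)
      fun _ => zdMean_le_of_le (fun _ => hg _) fun _ => h _

/-- **Monotone bound below**: `t ≤ g` pointwise gives `t ≤ zdMean d g`. [folklore] -/
theorem le_zdMean_of_le : ∀ {d : ℕ} {g : (Fin d → ℤ) → ℝ} {M t : ℝ}, (∀ x, |g x| ≤ M) →
    (∀ x, t ≤ g x) → t ≤ zdMean d g
  | 0, _, _, _, _, h => h _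
  | _ + 1, _, _, _, hg, h =>
    le_cLim_of_le (fun _ => abs_zdMean_le fun _ => hg _)
      fun _ => le_zdMean_of_le (fun _ => hg _) fun _ => h _

/-- **Positivity.** [folklore] -/
theorem zdMean_nonneg {d : ℕ} {g : (Fin d → ℤ) → ℝ} {M : ℝ} (hg : ∀ x, |g x| ≤ M)
    (h : ∀ x, 0 ≤ g x) : 0 ≤ zdMean d g :=
  le_zdMean_of_le hg h

/-! ## Translation invariance -/

/-- **A Banach limit of (the restriction to `ℕ` of) a bounded two-sided sequence is invariant under
every integer shift.** [folklore] -/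
theorem cLim_intShift {G : ℤ → ℝ} {M : ℝ} (hG : ∀ z, |G z| ≤ M) (a : ℤ) :
    cLim (fun n : ℕ => G (n + a)) = cLim (fun n : ℕ => G n) := by
  rcases Int.eq_nat_or_neg a with ⟨m, rfl | rfl⟩
  · have h := cLim_shift_add (a := fun n : ℕ => G n) (fun n => hG n) m
    simp only [Nat.cast_add] at h
    exact h
  · have hb : ∀ n : ℕ, |G (n + -(m : ℤ))| ≤ M := fun n => hG _
    have h := cLim_shift_add hb m
    refine h.symm.trans ?_
    congr 1
    funext n
    congr 1
    push_cast
    ring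

/-- Adding `a` to `Fin.cons x c` coordinatewise. -/
theorem cons_add_eq {d : ℕ} (x : ℤ) (c : Fin d → ℤ) (a : Fin (d + 1) → ℤ) :
    Fin.cons x c + a = Fin.cons (x + a 0) (c + Fin.tail a) := by
  funext i
  refine Fin.cases ?_ (fun j => ?_) i
  · simp only [Pi.add_apply, Fin.cons_zero]
  · simp only [Pi.add_apply, Fin.cons_succ]
    rfl

/-- ★ **Translation invariance of the mean**: `zdMean d (g (· + a)) = zdMean d g` for every
`a ∈ ℤ^d` and every bounded `g`. [folklore] -/
theorem zdMean_shift : ∀ {d : ℕ} {g : (Fin d → ℤ) → ℝ} {M : ℝ}, (∀ x, |g x| ≤ M) →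
    ∀ a : Fin d → ℤ, zdMean d (fun x => g (x + a)) = zdMean d g
  | 0, g, _, _, a => by
    rw [zdMean_zero, zdMean_zero]
    exact congrArg g (Subsingleton.elim _ _)
  | d + 1, g, M, hg, a => by
    rw [zdMean_succ, zdMean_succ]
    have h1 : ∀ n : ℕ, zdMean d (fun c => g (Fin.cons (n : ℤ) c + a)) =
        zdMean d (fun c => g (Fin.cons ((n : ℤ) + a 0) c)) := fun n => by
      simp only [cons_add_eq]
      exact zdMean_shift (g := fun c => g (Fin.cons ((n : ℤ) + a 0) c)) (fun c => hg _) (Fin.tail a)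
    simp only [h1]
    exact cLim_intShift (G := fun z => zdMean d (fun c => g (Fin.cons z c)))
      (fun z => abs_zdMean_le fun c => hg _) (a 0)

/-- ★ Translation invariance, `a + ·` form. -/
theorem zdMean_shift' {d : ℕ} {g : (Fin d → ℤ) → ℝ} {M : ℝ} (hg : ∀ x, |g x| ≤ M) (a : Fin d → ℤ) :
    zdMean d (fun x => g (a + x)) = zdMean d g := by
  simp only [add_comm a]
  exact zdMean_shift hg a

/-- **Squeeze**: if `lo ≤ g ≤ hi` pointwise then `lo ≤ zdMean d g ≤ hi`. -/
theorem zdMean_mem_Icc {d : ℕ} {g : (Fin d → ℤ) → ℝ} {lo hi : ℝ} (hlo : ∀ x, lo ≤ g x)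
    (hhi : ∀ x, g x ≤ hi) : zdMean d g ∈ Set.Icc lo hi := by
  have hb : ∀ x, |g x| ≤ max |lo| |hi| := fun x => by
    refine abs_le.2 ⟨?_, (hhi x).trans ((le_abs_self hi).trans (le_max_right _ _))⟩
    have h1 : -|lo| ≤ lo := neg_abs_le lo
    have h2 : |lo| ≤ max |lo| |hi| := le_max_left _ _
    linarith [hlo x]
  exact ⟨le_zdMean_of_le hb hlo, zdMean_le_of_le hb hhi⟩

end Summit.QuantumFields.GaugeBoot

end
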